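import Summits.ResolutionOfSingularities.ResolutionOfSingularities.Theorems.WeightedInvariantIota3Sigma
import Literature.AlgebraicGeometry.Resolution.CharPolyhedronMinimalIsMinimum
import Mathlib.RingTheory.PowerSeries.Inverse
import Mathlib.RingTheory.PowerSeries.Trunc
import Mathlib.RingTheory.PowerSeries.WeierstrassPreparation
import HarnessLib

/-!
# Sketch-R10b [OURS · L1 w43 · idea-2 gen 10] — HIRONAKA'S VERTEX THEOREM (4.8), ALREADY IN THE TREE, IS THE DOMINANCE OF
TRANSLATES OF A MINIMAL FIRST MEMBER (a candidate input for the (o70-b) residue = SPEC (Δ12) rev 4 l.223 `TwoFlagDominanceAtLevelAt`)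

Evidence for `stmt-ResolutionOfSingularities-0571` (crux `WeightedConstruction`), bearing on the door item
`stmt-ResolutionOfSingularities-19897` branch (o70-b).  AI-written, not expert-reviewed; the theorem below is a two-line COROLLARY of
tree theorems of `Literature/AlgebraicGeometry/Resolution/CharPolyhedronMinimalIsMinimum.lean` (Hironaka 1967 Thm. (4.8) =
Cossart–Piltant 2019 Prop. 2.2 (2), PROVED there; book form: Cossart–Jannsen–Saito LNM 2270 Thm. 8.16, p. 121); the DICTIONARY to the
w43 flag filtration in the second doc-comment is OURS and a CANDIDATE, not a claim that the residue is closed.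

## The corollary
`IsMinimal.mem_monomialIdeal_of_deltaGE_taylor`: `u₁ … u_N ∈ 𝔪_S` with (H), `(u)` radical, `h ∈ S[X]` monic of degree `≥ 1` with NO
SOLVABLE VERTEX (`IsMinimal u h`, Cossart–Piltant Def. 2.4); if a translate `h(X + φ)` satisfies `δ_α(h(X + φ); u; X) ≥ q` for a weight
vector `α > 0`, then `φ ∈ monomialIdeal u α q` (every minimal exponent of `φ` has `α`-weight `≥ q`).  Proof = the second branch of the
tree's proof of `IsMinimal.deltaGE_of_deltaGE_taylor`: otherwise `exists_isSolvableVertex_taylor_neg` produces a solvable vertex of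
`h(X + φ)(X - φ) = h`, contradicting minimality.  The tree states (4.8) as `δ_α(h(X+φ)) ≥ q ⇒ δ_α(h) ≥ q` (the minimal polyhedron is the
minimum); the form below — the TRANSLATION ITSELF is heavy — is what dominance needs, and holds for EVERY weight `α`, with no
separability hypothesis (the Lucas-degenerate binomials are handled inside `exists_isSolvableVertex_taylor_neg` by the exposed-point /
isolation argument).
-/

open Polynomial IsLocalRing
open Literature.AlgebraicGeometry.Resolution.CossartPiltant
open Summit.ResolutionOfSingularities.ResolutionOfSingularities.Theorems

namespace Summit.ResolutionOfSingularities.ResolutionOfSingularities.Cruxes.HypersurfaceCentreConstruction.LocalEngine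

namespace Iota3

namespace JCanCensus

universe u

variable {S : Type u} [CommRing S] {N : ℕ}

/-- **DOMINANCE OF TRANSLATES OF A MINIMAL MONIC POLYNOMIAL** (corollary of the tree's Hironaka (4.8)).  If `h ∈ S[X]` is monic of
degree `≥ 1` with no solvable vertex w.r.t. `(u; X)` and the translate `h(X + φ)` has `δ_α ≥ q`, then `φ` lies in the monomial
`u`-ideal of `α`-weight `≥ q`. [OURS · R10b · corollary of `CossartPiltant.exists_isSolvableVertex_taylor_neg`;
cite: Hironaka1967 Thm. (4.8); CossartPiltant2019 Prop. 2.2 (2); CossartJannsenSaito2020 Thm. 8.16] -/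
theorem IsMinimal.mem_monomialIdeal_of_deltaGE_taylor [IsNoetherianRing S] [IsLocalRing S] {u : Fin N → S}
    (H : ∀ (i : Fin N) (T : Finset (Fin N)), i ∉ T →
      ∀ y, u i * y ∈ Ideal.span (u '' ↑T) → y ∈ Ideal.span (u '' ↑T))
    (hu : ∀ i, u i ∈ maximalIdeal S) (hrad : (Ideal.span (Set.range u)).IsRadical)
    {h : S[X]} (hh : h.Monic) (hm : 1 ≤ h.natDegree) (hmin : IsMinimal u h) (φ : S)
    {α : Fin N → ℝ} (hα : ∀ j, 0 < α j) {q : ℝ} (hq : DeltaGE u α (taylor φ h) q) :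
    φ ∈ monomialIdeal u α q := by
  obtain ⟨-, hφP, hPmin⟩ := minExponents_spec' u H hu φ
  rw [mem_monomialIdeal_iff_of_minimal u (fun j => (hα j).le) hφP hPmin]
  intro b hb
  by_contra hbq
  push Not at hbq
  have hhφ : (taylor φ h).Monic := by
    rw [Monic, leadingCoeff_taylor]
    exact hh
  have hm1 : 1 ≤ (taylor φ h).natDegree := by
    rw [natDegree_taylor]
    exact hm
  obtain ⟨x, hx⟩ := exists_isSolvableVertex_taylor_neg u H hu hrad hhφ hm1 hα hq hb hbq
  rw [taylor_taylor, neg_add_cancel, taylor_zero] at hx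
  exact hmin x hx

/-- The same between TWO translates: if `h(X + θ)` is minimal and `h(X + θ')` reaches `δ_α ≥ q`, then `θ' - θ ∈ monomialIdeal u α q`
(apply the corollary to the minimal `h(X + θ)` and `φ = θ' - θ`). [OURS · R10b] -/
theorem IsMinimal.sub_mem_monomialIdeal_of_deltaGE_taylor [IsNoetherianRing S] [IsLocalRing S] {u : Fin N → S}
    (H : ∀ (i : Fin N) (T : Finset (Fin N)), i ∉ T →
      ∀ y, u i * y ∈ Ideal.span (u '' ↑T) → y ∈ Ideal.span (u '' ↑T))
    (hu : ∀ i, u i ∈ maximalIdeal S) (hrad : (Ideal.span (Set.range u)).IsRadical)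
    {h : S[X]} (hh : h.Monic) (hm : 1 ≤ h.natDegree) {θ θ' : S} (hmin : IsMinimal u (taylor θ h))
    {α : Fin N → ℝ} (hα : ∀ j, 0 < α j) {q : ℝ} (hq : DeltaGE u α (taylor θ' h) q) :
    θ' - θ ∈ monomialIdeal u α q := by
  have hhθ : (taylor θ h).Monic := by
    rw [Monic, leadingCoeff_taylor]
    exact hh
  have hmθ : 1 ≤ (taylor θ h).natDegree := by
    rw [natDegree_taylor]
    exact hm
  have hq' : DeltaGE u α (taylor (θ' - θ) (taylor θ h)) q := by
    rw [taylor_taylor, sub_add_cancel]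
    exact hq
  exact IsMinimal.mem_monomialIdeal_of_deltaGE_taylor H hu hrad hhθ hmθ hmin (θ' - θ) hα hq'

end JCanCensus

end Iota3

end Summit.ResolutionOfSingularities.ResolutionOfSingularities.Cruxes.HypersurfaceCentreConstruction.LocalEngine

/-! ## §3 THE BRIDGE — PROVED (rev 3, 2026-08-27T21:17Z)

(§3d) In ANY local ring `S` with `𝔪 = (x, g₂, g₁)` and `0 < q ≤ r₂ ≤ r₁`, res-D-brk-1's intrinsic two-flag filtration is Cossart–Piltant's
three-parameter monomial ideal: `flagContactFiltration g₁ g₂ q r₁ r₂ n = monomialIdeal (x, g₂, g₁) (q, r₂, r₁) n`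
(`flagContactFiltration_eq_monomialIdeal`).  (§3a–c) In `S₀⟦X⟧` (`S₀` local, `𝔪_{S₀} = (u₀, u₁)`), for EVERY polynomial `h ∈ S₀[X]`:
`h ∈ F_{(X; C u₁)}(r₁ ν) ↔ δ_α(h; u; X) ≥ 1`, `α = (q/r₁, r₂/r₁)` (`coe_mem_flagContactFiltration_iff_deltaGE`), hence the rev-2 candidate
`FlagDeltaBridge` HOLDS (`flagDeltaBridge_holds`).  What remains between §1 (Hironaka (4.8) as dominance of translates) and the `g₁`-clause of
l.223 for translates `(X − C φ; C u₁)`, `φ ∈ 𝔪_{S₀}`: the `S₀`-automorphism `X ↦ X + C φ` of `S₀⟦X⟧` (exists when `S₀` is `𝔪_{S₀}`-adically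
complete; in the model `K⟦x,y,z⟧ = MvPowerSeries (Fin 3) K` it is `MvPowerSeries.subst`, `HasSubst` holding because constant coefficients
vanish), OR — staying in the abstract `S` of the route — §3d for both frames `(x, g₂, g₁)` and `(x, g₂, g₁ − φ)` plus Cossart–Piltant's
change-of-parameter calculus (`exists_expansion_map_of_expansion`, `deltaGE_map_adicCompletion_iff`).  **UPDATE rev 4 (§3f): the automorphism
is NOT needed** — `mem_monomialIdeal_of_translate_flag_reaches` / `translate_first_member_mem` prove the `g₁`-clause for every reaching translate
flag `(X − C φ; C u₁)`, `φ ∈ 𝔪_{S₀}`, in `S₀⟦X⟧` for ANY Noetherian local `S₀` (Taylor is applied on `S₀[X]`, where it is an honest automorphism,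
after contracting the monomial ideal from `S₀⟦X⟧`).  [OURS · not expert-reviewed] -/

namespace Summit.ResolutionOfSingularities.ResolutionOfSingularities.Cruxes.HypersurfaceCentreConstruction.LocalEngine.Iota3.JCanCensus

/-! ### §3a Coefficientwise ideals of `S₀⟦X⟧` -/

section CoeffIdeal

variable {S₀ : Type*} [CommRing S₀]

/-- The ideal of power series whose `j`-th coefficient lies in `I j`, for a MONOTONE family `I` (so that it is an ideal).
[OURS · R10b §3a · bookkeeping] -/
def coeffIdeal (I : ℕ → Ideal S₀) (hI : Monotone I) : Ideal (PowerSeries S₀) where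
  carrier := {f | ∀ j, PowerSeries.coeff j f ∈ I j}
  add_mem' := by
    intro f g hf hg j
    simp only [map_add]
    exact (I j).add_mem (hf j) (hg j)
  zero_mem' := by
    intro j
    simp
  smul_mem' := by
    intro c f hf j
    simp only [smul_eq_mul, PowerSeries.coeff_mul]
    refine (I j).sum_mem fun p hp => ?_
    have hp2 : p.2 ≤ j := by
      have := Finset.HasAntidiagonal.mem_antidiagonal.mp hp
      omega
    exact (I j).mul_mem_left _ (hI hp2 (hf p.2))

theorem mem_coeffIdeal {I : ℕ → Ideal S₀} {hI : Monotone I} {f : PowerSeries S₀} :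
    f ∈ coeffIdeal I hI ↔ ∀ j, PowerSeries.coeff j f ∈ I j := Iff.rfl

/-- Convolution: `J(I) · J(I') ⊆ J(I'')` whenever `I a · I' b ⊆ I'' (a + b)`. [OURS · R10b §3a · bookkeeping] -/
theorem coeffIdeal_mul_le {I I' I'' : ℕ → Ideal S₀} (hI : Monotone I) (hI' : Monotone I') (hI'' : Monotone I'')
    (h : ∀ a b, I a * I' b ≤ I'' (a + b)) :
    coeffIdeal I hI * coeffIdeal I' hI' ≤ coeffIdeal I'' hI'' := by
  refine Ideal.mul_le.mpr fun f hf g hg => ?_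
  rw [mem_coeffIdeal]
  intro j
  rw [PowerSeries.coeff_mul]
  refine (I'' j).sum_mem fun p hp => ?_
  have hpj : p.1 + p.2 = j := Finset.HasAntidiagonal.mem_antidiagonal.mp hp
  exact hpj ▸ h p.1 p.2 (Ideal.mul_mem_mul (hf p.1) (hg p.2))

variable [IsLocalRing S₀]

/-- `f ∈ 𝔪_{S₀⟦X⟧} ↔ f(0) ∈ 𝔪_{S₀}`. [folklore] -/
theorem mem_maximalIdeal_powerSeries_iff {f : PowerSeries S₀} :
    f ∈ maximalIdeal (PowerSeries S₀) ↔ PowerSeries.constantCoeff f ∈ maximalIdeal S₀ := by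
  simp only [IsLocalRing.mem_maximalIdeal, mem_nonunits_iff, PowerSeries.isUnit_iff_constantCoeff]

/-- The coefficient profile of `𝔪^e`: `coeff_j ∈ 𝔪₀^(e - j)`. -/
def mPowCoeff (S₀ : Type*) [CommRing S₀] [IsLocalRing S₀] (e : ℕ) : ℕ → Ideal S₀ := fun j => maximalIdeal S₀ ^ (e - j)

theorem mPowCoeff_mono (e : ℕ) : Monotone (mPowCoeff S₀ e) :=
  fun a b hab => Ideal.pow_le_pow_right (by omega)

theorem maximalIdeal_le_coeffIdeal_one :
    maximalIdeal (PowerSeries S₀) ≤ coeffIdeal (mPowCoeff S₀ 1) (mPowCoeff_mono 1) := by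
  intro f hf
  rw [mem_coeffIdeal]
  intro j
  rcases j with _ | j
  · simpa [mPowCoeff] using (mem_maximalIdeal_powerSeries_iff.mp hf)
  · simp [mPowCoeff]

/-- **`𝔪^e ⊆ J(𝔪₀^(e - ·))`**: the `j`-th coefficient of an element of `𝔪_{S₀⟦X⟧}^e` lies in `𝔪_{S₀}^(e-j)`. [OURS · R10b §3a] -/
theorem maximalIdeal_pow_le_coeffIdeal (e : ℕ) :
    maximalIdeal (PowerSeries S₀) ^ e ≤ coeffIdeal (mPowCoeff S₀ e) (mPowCoeff_mono e) := by
  induction e with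
  | zero =>
    intro f _
    rw [mem_coeffIdeal]
    intro j
    simp [mPowCoeff]
  | succ e ih =>
    rw [pow_succ]
    refine (Ideal.mul_mono ih maximalIdeal_le_coeffIdeal_one).trans ?_
    refine coeffIdeal_mul_le _ _ _ fun a b => ?_
    simp only [mPowCoeff, ← pow_add]
    exact Ideal.pow_le_pow_right (by omega)

end CoeffIdeal

/-! ### §3b Weighted monomial ideals: two small lemmas -/

section Weights

variable {S : Type*} [CommRing S] {N : ℕ}

/-- `(u)^t ⊆ I_α(c t)` when `0 ≤ c ≤ α_j` for all `j`. [OURS · R10b §3b · after CossartPiltant2019 Ch. 2 (v1 p. 9)] -/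
theorem span_pow_le_monomialIdeal_of_le (u : Fin N → S) {α : Fin N → ℝ} {c : ℝ} (hc : 0 ≤ c)
    (hα : ∀ j, c ≤ α j) (t : ℕ) :
    Ideal.span (Set.range u) ^ t ≤ monomialIdeal u α (c * t) := by
  refine (span_pow_le_monomialIdeal_one u t).trans ?_
  apply Ideal.span_mono
  rintro m ⟨x, hx, rfl⟩
  refine ⟨x, ?_, rfl⟩
  calc c * t ≤ c * weight (fun _ => (1 : ℝ)) x := mul_le_mul_of_nonneg_left hx hc
    _ = ∑ j, c * (x j : ℝ) := by simp [weight, Finset.mul_sum]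
    _ ≤ ∑ j, α j * (x j : ℝ) := Finset.sum_le_sum fun j _ => mul_le_mul_of_nonneg_right (hα j) (Nat.cast_nonneg _)
    _ = weight α x := rfl

/-- `u_j^b ∈ I_α(α_j b)`. [OURS · R10b §3b] -/
theorem pow_mem_monomialIdeal_weight (u : Fin N → S) (α : Fin N → ℝ) (j : Fin N) (b : ℕ) :
    u j ^ b ∈ monomialIdeal u α (α j * b) := by
  have hw : ∀ b : ℕ, weight α (b • Pi.single j 1) = α j * b := by
    intro b
    induction b with
    | zero => simp
    | succ b ih => rw [succ_nsmul, weight_add, weight_single, ih]; push_cast; ring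
  have h1 : ∀ b : ℕ, u j ^ b = uPow u (b • Pi.single j 1) := by
    intro b
    induction b with
    | zero => simp
    | succ b ih => rw [pow_succ, ih, succ_nsmul, uPow_add, uPow_single]
  rw [h1]
  exact uPow_mem_monomialIdeal u (le_of_eq (hw b).symm)

end Weights

/-! ### §3c The bridge -/

section Bridge

variable {S₀ : Type*} [CommRing S₀] [IsLocalRing S₀]

/-- The weights `α = (q/r₁, r₂/r₁)` of the dictionary. -/
noncomputable def bridgeWeights (q r₁ r₂ : ℕ) : Fin 2 → ℝ := fun i => if i = 0 then (q : ℝ) / r₁ else (r₂ : ℝ) / r₁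

@[simp] theorem bridgeWeights_zero (q r₁ r₂ : ℕ) : bridgeWeights q r₁ r₂ 0 = (q : ℝ) / r₁ := by simp [bridgeWeights]
@[simp] theorem bridgeWeights_one (q r₁ r₂ : ℕ) : bridgeWeights q r₁ r₂ 1 = (r₂ : ℝ) / r₁ := by simp [bridgeWeights]

theorem weight_bridgeWeights (q r₁ r₂ : ℕ) (x : Fin 2 → ℕ) :
    weight (bridgeWeights q r₁ r₂) x = (q : ℝ) / r₁ * x 0 + (r₂ : ℝ) / r₁ * x 1 := by
  simp [weight, Fin.sum_univ_two]

/-- **BRIDGE, direction `⊆`**: `F(r₁ ν) ⊆ J(j ↦ I_α(ν − j))` for the flag `(X; C u₁)` of `S₀⟦X⟧`, `𝔪_{S₀} = (u₀, u₁)`, `0 < q ≤ r₂ ≤ r₁`.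
[OURS · R10b §3c] -/
theorem flagContactFiltration_le_coeffIdeal (u : Fin 2 → S₀) (hm : maximalIdeal S₀ = Ideal.span (Set.range u))
    {q r₁ r₂ : ℕ} (hadm : AdmissibleTriple q r₁ r₂) (ν : ℕ) :
    flagContactFiltration (PowerSeries.X : PowerSeries S₀) (PowerSeries.C (u 1)) q r₁ r₂ (r₁ * ν) ≤
      coeffIdeal (fun j => monomialIdeal u (bridgeWeights q r₁ r₂) ((ν : ℝ) - j))
        (fun a b hab => monomialIdeal_antitone u _ (sub_le_sub_left (Nat.cast_le.mpr hab) _)) := by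
  obtain ⟨hq, hqr₂, hr₂r₁⟩ := hadm
  have hr₁ : (0 : ℝ) < r₁ := by exact_mod_cast (lt_of_lt_of_le hq (hqr₂.trans hr₂r₁))
  have hc : (0 : ℝ) ≤ (q : ℝ) / r₁ := by positivity
  have hcα : ∀ j, (q : ℝ) / r₁ ≤ bridgeWeights q r₁ r₂ j := by
    intro j
    fin_cases j
    · simp
    · show (q : ℝ) / r₁ ≤ bridgeWeights q r₁ r₂ 1
      rw [bridgeWeights_one]
      exact div_le_div_of_nonneg_right (by exact_mod_cast hqr₂) hr₁.le
  rw [flagContactFiltration_def]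
  refine iSup_le fun a => iSup_le fun b => ?_
  refine Ideal.mul_le.mpr fun s hs g hg => ?_
  obtain ⟨t, rfl⟩ := Ideal.mem_span_singleton'.mp hs
  set e := (r₁ * ν - r₁ * a - r₂ * b + q - 1) / q with he
  have hg' : t * g ∈ maximalIdeal (PowerSeries S₀) ^ e := Ideal.mul_mem_left _ _ hg
  have hcoef := mem_coeffIdeal.mp (maximalIdeal_pow_le_coeffIdeal e hg')
  have hEq : t * (PowerSeries.X ^ a * PowerSeries.C (u 1) ^ b) * g =
      PowerSeries.X ^ a * (PowerSeries.C (u 1 ^ b) * (t * g)) := by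
    rw [map_pow]; ring
  rw [hEq, mem_coeffIdeal]
  intro j
  rw [PowerSeries.coeff_X_pow_mul']
  split_ifs with haj
  · rw [PowerSeries.coeff_C_mul]
    -- `u₁^b · c` with `c ∈ 𝔪₀^(e - (j - a))`
    have hcj := hcoef (j - a)
    simp only [mPowCoeff] at hcj
    set d := j - a with hd
    set tt := e - d with htt
    have h1 : u 1 ^ b ∈ monomialIdeal u (bridgeWeights q r₁ r₂) ((r₂ : ℝ) / r₁ * b) := by
      simpa using pow_mem_monomialIdeal_weight u (bridgeWeights q r₁ r₂) 1 b
    have h2 : PowerSeries.coeff d (t * g) ∈ monomialIdeal u (bridgeWeights q r₁ r₂) ((q : ℝ) / r₁ * tt) := by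
      refine span_pow_le_monomialIdeal_of_le u hc hcα tt ?_
      rw [← hm]
      exact hcj
    have h12 := monomialIdeal_mul_le u (bridgeWeights q r₁ r₂) _ _ (Ideal.mul_mem_mul h1 h2)
    refine monomialIdeal_antitone u _ ?_ h12
    -- the arithmetic: `ν - j ≤ (r₂ b + q tt)/r₁`
    have hme : r₁ * ν - r₁ * a - r₂ * b ≤ q * e := by
      have h0 := Nat.lt_div_mul_add (a := r₁ * ν - r₁ * a - r₂ * b + q - 1) hq
      rw [← he, Nat.mul_comm e q] at h0
      omega
    have hE : q * e ≤ q * tt + q * d := by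
      rw [← mul_add]
      exact Nat.mul_le_mul_left q (by omega)
    have hqd : q * d ≤ r₁ * d := Nat.mul_le_mul_right d (hqr₂.trans hr₂r₁)
    have hjd : r₁ * j = r₁ * a + r₁ * d := by rw [hd, ← mul_add]; congr 1; omega
    have hN : r₁ * ν ≤ r₁ * j + r₂ * b + q * tt := by omega
    have hR : (r₁ : ℝ) * ν ≤ r₁ * j + r₂ * b + q * tt := by exact_mod_cast hN
    rw [div_mul_eq_mul_div, div_mul_eq_mul_div, ← add_div, le_div_iff₀ hr₁]
    linarith
  · simp

/-- **BRIDGE, direction `⊇`** (generators): `C c · X^i ∈ F(r₁ ν)` for `c ∈ I_α(ν − i)`, `i ≤ ν`. [OURS · R10b §3c] -/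
theorem C_mul_X_pow_mem_flagContactFiltration (u : Fin 2 → S₀) (hm : maximalIdeal S₀ = Ideal.span (Set.range u))
    {q r₁ r₂ : ℕ} (hadm : AdmissibleTriple q r₁ r₂) {ν i : ℕ} (hi : i ≤ ν) {c : S₀}
    (hc : c ∈ monomialIdeal u (bridgeWeights q r₁ r₂) (((ν - i : ℕ) : ℝ))) :
    PowerSeries.C c * PowerSeries.X ^ i ∈
      flagContactFiltration (PowerSeries.X : PowerSeries S₀) (PowerSeries.C (u 1)) q r₁ r₂ (r₁ * ν) := by
  obtain ⟨hq, hqr₂, hr₂r₁⟩ := hadm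
  have hr₁ : (0 : ℝ) < r₁ := by exact_mod_cast (lt_of_lt_of_le hq (hqr₂.trans hr₂r₁))
  have hu0 : PowerSeries.C (u 0) ∈ maximalIdeal (PowerSeries S₀) := by
    rw [mem_maximalIdeal_powerSeries_iff, PowerSeries.constantCoeff_C, hm]
    exact Ideal.subset_span ⟨0, rfl⟩
  induction hc using Submodule.span_induction with
  | mem m hmm =>
    obtain ⟨x, hx, rfl⟩ := hmm
    rw [weight_bridgeWeights, Nat.cast_sub hi] at hx
    -- `r₁ (ν - i) ≤ q x₀ + r₂ x₁`
    have hR : (r₁ : ℝ) * ν ≤ r₁ * i + q * x 0 + r₂ * x 1 := by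
      have := (le_div_iff₀ hr₁).mp (show ((ν : ℝ) - i) ≤ ((q : ℝ) * x 0 + r₂ * x 1) / r₁ by
        rw [add_div, ← div_mul_eq_mul_div, ← div_mul_eq_mul_div]; exact hx)
      linarith
    have hN : r₁ * ν ≤ r₁ * i + q * x 0 + r₂ * x 1 := by exact_mod_cast hR
    have huPow : uPow u x = u 0 ^ x 0 * u 1 ^ x 1 := by simp [uPow, Fin.prod_univ_two]
    rw [huPow, map_mul, map_pow, map_pow]
    have hEq : PowerSeries.C (u 0) ^ x 0 * PowerSeries.C (u 1) ^ x 1 * PowerSeries.X ^ i =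
        PowerSeries.X ^ i * PowerSeries.C (u 1) ^ x 1 * PowerSeries.C (u 0) ^ x 0 := by ring
    rw [hEq, flagContactFiltration_def]
    refine Submodule.mem_iSup_of_mem i (Submodule.mem_iSup_of_mem (x 1) ?_)
    refine Ideal.mul_mem_mul (Ideal.mem_span_singleton_self _) ?_
    have he : (r₁ * ν - r₁ * i - r₂ * x 1 + q - 1) / q ≤ x 0 := by
      refine Nat.lt_succ_iff.mp ((Nat.div_lt_iff_lt_mul hq).mpr ?_)
      have : (x 0 + 1) * q = q * x 0 + q := by ring
      rw [Nat.succ_eq_add_one, this]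
      omega
    exact Ideal.pow_le_pow_right he (Ideal.pow_mem_pow hu0 _)
  | zero => simp
  | add c d _ _ hc hd =>
    rw [map_add, add_mul]
    exact Ideal.add_mem _ hc hd
  | smul s c _ hc =>
    rw [smul_eq_mul, map_mul, mul_assoc]
    exact Ideal.mul_mem_left _ _ hc

/-- **THE BRIDGE (R10b §3 · OURS · PROVED)**: for a monic `h ∈ S₀[X]` of degree `ν`, `𝔪_{S₀} = (u₀, u₁)`, `0 < q ≤ r₂ ≤ r₁`:
`h ∈ F_{(X; C u₁)}(r₁ ν) ⊆ S₀⟦X⟧ ↔ δ_α(h; u; X) ≥ 1` with `α = (q/r₁, r₂/r₁)` — the intrinsic two-flag filtration (res-D-brk-1) meets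
Cossart–Piltant's `DeltaGE`.  (Monicity is not even needed.) [OURS · R10b §3c] -/
theorem coe_mem_flagContactFiltration_iff_deltaGE (u : Fin 2 → S₀) (hm : maximalIdeal S₀ = Ideal.span (Set.range u))
    {q r₁ r₂ : ℕ} (hadm : AdmissibleTriple q r₁ r₂) (h : S₀[X]) :
    ((h : PowerSeries S₀) ∈ flagContactFiltration (PowerSeries.X : PowerSeries S₀) (PowerSeries.C (u 1)) q r₁ r₂ (r₁ * h.natDegree)
      ↔ DeltaGE u (bridgeWeights q r₁ r₂) h 1) := by
  constructor
  · intro hmem i hi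
    rw [Finset.mem_Icc] at hi
    have hc := mem_coeffIdeal.mp (flagContactFiltration_le_coeffIdeal u hm hadm h.natDegree hmem) (h.natDegree - i)
    rw [Polynomial.coeff_coe, Nat.cast_sub hi.2] at hc
    simpa using hc
  · intro hδ
    have hsum : ((h : S₀[X]) : PowerSeries S₀) =
        ∑ j ∈ Finset.range (h.natDegree + 1), PowerSeries.C (h.coeff j) * PowerSeries.X ^ j := by
      have := congrArg (Polynomial.coeToPowerSeries.ringHom (R := S₀)) h.as_sum_range_C_mul_X_pow
      simpa [map_sum, Polynomial.coeToPowerSeries.ringHom_apply, Polynomial.coe_C, Polynomial.coe_X] using this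
    rw [hsum]
    refine Ideal.sum_mem _ fun j hj => ?_
    rw [Finset.mem_range] at hj
    refine C_mul_X_pow_mem_flagContactFiltration u hm hadm (Nat.le_of_lt_succ hj) ?_
    by_cases hjν : j = h.natDegree
    · rw [hjν, Nat.sub_self, Nat.cast_zero, monomialIdeal_of_nonpos u _ le_rfl]
      exact Submodule.mem_top
    · have hk : 1 ≤ h.natDegree - j ∧ h.natDegree - j ≤ h.natDegree := by omega
      have := hδ (h.natDegree - j) (Finset.mem_Icc.mpr hk)
      rw [mul_one, show h.natDegree - (h.natDegree - j) = j by omega] at this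
      exact this

/-- `FlagDeltaBridge` (the candidate of rev 2) HOLDS — for every local `S₀`, with hypothesis (H) unused. [OURS · R10b §3c] -/
theorem flagDeltaBridge_holds' (S₀ : Type) [CommRing S₀] [IsLocalRing S₀] :
    ∀ (u : Fin 2 → S₀) (h : S₀[X]) (q r₁ r₂ : ℕ), h.Monic → AdmissibleTriple q r₁ r₂ →
    maximalIdeal S₀ = Ideal.span (Set.range u) →
    (∀ (i : Fin 2) (T : Finset (Fin 2)), i ∉ T → ∀ y, u i * y ∈ Ideal.span (u '' ↑T) → y ∈ Ideal.span (u '' ↑T)) →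
    ((h : PowerSeries S₀) ∈ flagContactFiltration (PowerSeries.X : PowerSeries S₀) (PowerSeries.C (u 1)) q r₁ r₂ (r₁ * h.natDegree)
      ↔ DeltaGE u (fun i => if i = 0 then (q : ℝ) / r₁ else (r₂ : ℝ) / r₁) h 1) := by
  intro u h q r₁ r₂ _ hadm hm _
  exact coe_mem_flagContactFiltration_iff_deltaGE u hm hadm h


/-- **§3e THE `g₁`-CLAUSE FOR TRANSLATES, modulo the automorphism `X ↦ X + C φ` (R10b · OURS · PROVED)**.  `S₀` Noetherian local with
`𝔪_{S₀} = (u₀, u₁)` radical-generated and (H); `h ∈ S₀[X]` monic of degree `ν ≥ 1` with NO solvable vertex (`IsMinimal u h` — the hub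
first member is `X`); `φ ∈ S₀`.  IF the flag `(X; C u₁)` reaches the translate `h(X + φ)` at level `r₁ ν` — which, transported by the
`S₀`-automorphism `X ↦ X + C φ` of `S₀⟦X⟧` (available for `S₀` complete, `φ ∈ 𝔪_{S₀}`), says: THE TRANSLATE FLAG `(X − C φ; C u₁)` REACHES
`h` — THEN `φ ∈ I_α(u; 1)`, `α = (q/r₁, r₂/r₁)`, i.e. `q·a + r₂·b ≥ r₁` on the minimal exponents of `φ`: the competing first member `X − C φ`
lies in `F_{(X; C u₁)}(r₁)` — the `g₁`-clause of `TwoFlagDominanceAtLevelAt` (SPEC (Δ12) rev 4 l.223) for translates, at EVERY ratio,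
separable or not.  Two lines: §3c + §1. [OURS · R10b §3e · PROVED modulo the named automorphism, which the user supplies in the model] -/
theorem mem_monomialIdeal_of_translate_reaches [IsNoetherianRing S₀] (u : Fin 2 → S₀)
    (hm : maximalIdeal S₀ = Ideal.span (Set.range u))
    (H : ∀ (i : Fin 2) (T : Finset (Fin 2)), i ∉ T →
      ∀ y, u i * y ∈ Ideal.span (u '' ↑T) → y ∈ Ideal.span (u '' ↑T))
    (hrad : (Ideal.span (Set.range u)).IsRadical)
    {h : S₀[X]} (hh : h.Monic) (hm1 : 1 ≤ h.natDegree) (hmin : IsMinimal u h)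
    {q r₁ r₂ : ℕ} (hadm : AdmissibleTriple q r₁ r₂) (φ : S₀)
    (hreach : ((taylor φ h : S₀[X]) : PowerSeries S₀) ∈
      flagContactFiltration (PowerSeries.X : PowerSeries S₀) (PowerSeries.C (u 1)) q r₁ r₂ (r₁ * h.natDegree)) :
    φ ∈ monomialIdeal u (bridgeWeights q r₁ r₂) 1 := by
  have hu : ∀ i, u i ∈ maximalIdeal S₀ := fun i => by rw [hm]; exact Ideal.subset_span ⟨i, rfl⟩
  obtain ⟨hq, hqr₂, hr₂r₁⟩ := hadm
  have hα : ∀ j, 0 < bridgeWeights q r₁ r₂ j := by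
    have hr₁ : (0 : ℝ) < r₁ := by exact_mod_cast (lt_of_lt_of_le hq (hqr₂.trans hr₂r₁))
    intro j
    fin_cases j
    · simp only [bridgeWeights_zero, Fin.zero_eta]
      exact div_pos (by exact_mod_cast hq) hr₁
    · simp only [bridgeWeights_one, Fin.mk_one]
      exact div_pos (by exact_mod_cast (lt_of_lt_of_le hq hqr₂)) hr₁
  have h1 : DeltaGE u (bridgeWeights q r₁ r₂) (taylor φ h) 1 := by
    refine (coe_mem_flagContactFiltration_iff_deltaGE u hm ⟨hq, hqr₂, hr₂r₁⟩ (taylor φ h)).mp ?_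
    rwa [natDegree_taylor]
  exact IsMinimal.mem_monomialIdeal_of_deltaGE_taylor H hu hrad hh hm1 hmin φ hα h1

/-- Read-out of §3e in flag words: under its hypotheses the competing first member `X − C φ` lies in `F_{(X; C u₁)}(r₁)`.
[OURS · R10b §3e · PROVED] -/
theorem translate_first_member_mem_flagContactFiltration [IsNoetherianRing S₀] (u : Fin 2 → S₀)
    (hm : maximalIdeal S₀ = Ideal.span (Set.range u))
    (H : ∀ (i : Fin 2) (T : Finset (Fin 2)), i ∉ T →
      ∀ y, u i * y ∈ Ideal.span (u '' ↑T) → y ∈ Ideal.span (u '' ↑T))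
    (hrad : (Ideal.span (Set.range u)).IsRadical)
    {h : S₀[X]} (hh : h.Monic) (hm1 : 1 ≤ h.natDegree) (hmin : IsMinimal u h)
    {q r₁ r₂ : ℕ} (hadm : AdmissibleTriple q r₁ r₂) (φ : S₀)
    (hreach : ((taylor φ h : S₀[X]) : PowerSeries S₀) ∈
      flagContactFiltration (PowerSeries.X : PowerSeries S₀) (PowerSeries.C (u 1)) q r₁ r₂ (r₁ * h.natDegree)) :
    PowerSeries.X - PowerSeries.C φ ∈
      flagContactFiltration (PowerSeries.X : PowerSeries S₀) (PowerSeries.C (u 1)) q r₁ r₂ r₁ := by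
  have hφ := mem_monomialIdeal_of_translate_reaches u hm H hrad hh hm1 hmin hadm φ hreach
  have hq : 0 < q := hadm.1
  refine Ideal.sub_mem _ ?_ ?_
  · -- `X = X^1 · (C u₁)^0 · 1 ∈ span{X} · 𝔪^0`
    rw [flagContactFiltration_def]
    refine Submodule.mem_iSup_of_mem 1 (Submodule.mem_iSup_of_mem 0 ?_)
    have h0 : (r₁ - r₁ * 1 - r₂ * 0 + q - 1) / q = 0 := by
      rw [Nat.div_eq_zero_iff]; right; omega
    have hX : (PowerSeries.X : PowerSeries S₀) ∈
        Ideal.span {(PowerSeries.X : PowerSeries S₀) ^ 1 * PowerSeries.C (u 1) ^ 0} := by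
      simp [Ideal.mem_span_singleton_self]
    have h1 : (1 : PowerSeries S₀) ∈ maximalIdeal (PowerSeries S₀) ^ ((r₁ - r₁ * 1 - r₂ * 0 + q - 1) / q) := by
      rw [h0, pow_zero, Ideal.one_eq_top]; exact Submodule.mem_top
    simpa using Ideal.mul_mem_mul hX h1
  · -- `C φ = C φ · X^0 ∈ F(r₁ · 1)` by §3c's generator lemma with `ν = 1`, `i = 0`
    have := C_mul_X_pow_mem_flagContactFiltration u hm hadm (ν := 1) (i := 0) (Nat.zero_le 1) (c := φ) (by simpa using hφ)
    simpa using this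

/-- The rev-2 CANDIDATE, verbatim. -/
def FlagDeltaBridge (S₀ : Type) [CommRing S₀] [IsLocalRing S₀] : Prop :=
  ∀ (u : Fin 2 → S₀) (h : S₀[X]) (q r₁ r₂ : ℕ), h.Monic → AdmissibleTriple q r₁ r₂ →
    maximalIdeal S₀ = Ideal.span (Set.range u) →
    (∀ (i : Fin 2) (T : Finset (Fin 2)), i ∉ T → ∀ y, u i * y ∈ Ideal.span (u '' ↑T) → y ∈ Ideal.span (u '' ↑T)) →
    ((h : PowerSeries S₀) ∈ flagContactFiltration (PowerSeries.X : PowerSeries S₀) (PowerSeries.C (u 1)) q r₁ r₂ (r₁ * h.natDegree)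
      ↔ DeltaGE u (fun i => if i = 0 then (q : ℝ) / r₁ else (r₂ : ℝ) / r₁) h 1)

/-- **`FlagDeltaBridge` HOLDS** for every local `S₀` (monicity and (H) unused). [OURS · R10b §3c · PROVED] -/
theorem flagDeltaBridge_holds (S₀ : Type) [CommRing S₀] [IsLocalRing S₀] : FlagDeltaBridge S₀ :=
  flagDeltaBridge_holds' S₀

end Bridge

/-! ### §3d The intrinsic two-flag filtration IS a three-parameter monomial ideal (any local `S`) -/

section Intrinsic

variable {S : Type*} [CommRing S] [IsLocalRing S]

/-- The weights `(q, r₂, r₁)` on the frame `u = (x, g₂, g₁)`. -/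
noncomputable def frameWeights (q r₁ r₂ : ℕ) : Fin 3 → ℝ :=
  fun i => if i = 0 then (q : ℝ) else if i = 1 then (r₂ : ℝ) else (r₁ : ℝ)

@[simp] theorem frameWeights_zero (q r₁ r₂ : ℕ) : frameWeights q r₁ r₂ 0 = q := by simp [frameWeights]
@[simp] theorem frameWeights_one (q r₁ r₂ : ℕ) : frameWeights q r₁ r₂ 1 = r₂ := by simp [frameWeights]
@[simp] theorem frameWeights_two (q r₁ r₂ : ℕ) : frameWeights q r₁ r₂ 2 = r₁ := by
  simp [frameWeights, show (2 : Fin 3) ≠ 0 from by decide, show (2 : Fin 3) ≠ 1 from by decide]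

theorem weight_frameWeights (q r₁ r₂ : ℕ) (x : Fin 3 → ℕ) :
    weight (frameWeights q r₁ r₂) x = (q : ℝ) * x 0 + (r₂ : ℝ) * x 1 + (r₁ : ℝ) * x 2 := by
  simp [weight, Fin.sum_univ_three]

/-- **INTRINSIC = MONOMIAL (R10b §3d · OURS · PROVED)**: in a local ring `S` with `𝔪 = (u₀, u₁, u₂) = (x, g₂, g₁)` and `0 < q ≤ r₂ ≤ r₁`,
res-D-brk-1's two-flag filtration of the flag `(g₁; g₂) = (u₂; u₁)` is Cossart–Piltant's monomial ideal of the frame `u` with weights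
`(q, r₂, r₁)`:  `F_{(g₁; g₂)}(n) = I_{(q, r₂, r₁)}(u; n)`.  No coefficient ring, no completeness. [OURS · R10b §3d] -/
theorem flagContactFiltration_eq_monomialIdeal (u : Fin 3 → S) (hm : maximalIdeal S = Ideal.span (Set.range u))
    {q r₁ r₂ : ℕ} (hadm : AdmissibleTriple q r₁ r₂) (n : ℕ) :
    flagContactFiltration (u 2) (u 1) q r₁ r₂ n = monomialIdeal u (frameWeights q r₁ r₂) n := by
  obtain ⟨hq, hqr₂, hr₂r₁⟩ := hadm
  have hc : (0 : ℝ) ≤ (q : ℝ) := by positivity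
  have hcα : ∀ j, (q : ℝ) ≤ frameWeights q r₁ r₂ j := by
    intro j
    fin_cases j
    · simp
    · simpa using (show (q : ℝ) ≤ r₂ by exact_mod_cast hqr₂)
    · simpa using (show (q : ℝ) ≤ r₁ by exact_mod_cast (hqr₂.trans hr₂r₁))
  apply le_antisymm
  · rw [flagContactFiltration_def]
    refine iSup_le fun a => iSup_le fun b => ?_
    set e := (n - r₁ * a - r₂ * b + q - 1) / q with he
    have h1 : u 2 ^ a * u 1 ^ b ∈ monomialIdeal u (frameWeights q r₁ r₂) ((r₁ : ℝ) * a + (r₂ : ℝ) * b) := by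
      have ha := pow_mem_monomialIdeal_weight u (frameWeights q r₁ r₂) 2 a
      have hb := pow_mem_monomialIdeal_weight u (frameWeights q r₁ r₂) 1 b
      simp only [frameWeights_two, frameWeights_one] at ha hb
      exact monomialIdeal_mul_le u _ _ _ (Ideal.mul_mem_mul ha hb)
    have h2 : maximalIdeal S ^ e ≤ monomialIdeal u (frameWeights q r₁ r₂) ((q : ℝ) * e) := by
      rw [hm]
      exact span_pow_le_monomialIdeal_of_le u hc hcα e
    calc Ideal.span {u 2 ^ a * u 1 ^ b} * maximalIdeal S ^ e
        ≤ monomialIdeal u (frameWeights q r₁ r₂) ((r₁ : ℝ) * a + (r₂ : ℝ) * b) *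
            monomialIdeal u (frameWeights q r₁ r₂) ((q : ℝ) * e) :=
          Ideal.mul_mono ((Ideal.span_singleton_le_iff_mem _).mpr h1) h2
      _ ≤ monomialIdeal u (frameWeights q r₁ r₂) ((r₁ : ℝ) * a + (r₂ : ℝ) * b + (q : ℝ) * e) := monomialIdeal_mul_le u _ _ _
      _ ≤ monomialIdeal u (frameWeights q r₁ r₂) n := monomialIdeal_antitone u _ ?_
    have hme : n - r₁ * a - r₂ * b ≤ q * e := by
      have h0 := Nat.lt_div_mul_add (a := n - r₁ * a - r₂ * b + q - 1) hq
      rw [← he, Nat.mul_comm e q] at h0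
      omega
    have hN : n ≤ r₁ * a + r₂ * b + q * e := by omega
    exact_mod_cast hN
  · rw [monomialIdeal, Ideal.span_le]
    rintro m ⟨x, hx, rfl⟩
    rw [weight_frameWeights] at hx
    have hN : n ≤ q * x 0 + r₂ * x 1 + r₁ * x 2 := by exact_mod_cast hx
    have huPow : uPow u x = u 2 ^ x 2 * u 1 ^ x 1 * u 0 ^ x 0 := by
      simp [uPow, Fin.prod_univ_three]; ring
    rw [SetLike.mem_coe, huPow, flagContactFiltration_def]
    refine Submodule.mem_iSup_of_mem (x 2) (Submodule.mem_iSup_of_mem (x 1) ?_)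
    refine Ideal.mul_mem_mul (Ideal.mem_span_singleton_self _) ?_
    have hu0 : u 0 ∈ maximalIdeal S := by rw [hm]; exact Ideal.subset_span ⟨0, rfl⟩
    have he : (n - r₁ * x 2 - r₂ * x 1 + q - 1) / q ≤ x 0 := by
      refine Nat.lt_succ_iff.mp ((Nat.div_lt_iff_lt_mul hq).mpr ?_)
      have : (x 0 + 1) * q = q * x 0 + q := by ring
      rw [Nat.succ_eq_add_one, this]
      omega
    exact Ideal.pow_le_pow_right he (Ideal.pow_mem_pow hu0 _)

end Intrinsic

/-! ### §3f Removing the automorphism: contraction along `S₀[X] → S₀⟦X⟧` and Taylor on `S₀[X]` -/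

section Contraction

variable {S₀ : Type*} [CommRing S₀]

/-- Truncations of elements of `J · S₀⟦X⟧` lie in `J` as soon as `X^L ∈ J` (`N ≥ L`). [OURS · R10b §3f] -/
theorem trunc_mem_of_mem_map_coe {J : Ideal S₀[X]} {L : ℕ} (hXL : (X : S₀[X]) ^ L ∈ J) {g : PowerSeries S₀}
    (hg : g ∈ J.map (Polynomial.coeToPowerSeries.ringHom : S₀[X] →+* PowerSeries S₀)) {N : ℕ} (hN : L ≤ N) :
    PowerSeries.trunc N g ∈ J := by
  -- the key step: for a POLYNOMIAL `m ∈ J`, `trunc N ↑m ∈ J`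
  have key : ∀ m : S₀[X], m ∈ J → PowerSeries.trunc N (m : PowerSeries S₀) ∈ J := by
    intro m hm
    have hdvd : (X : S₀[X]) ^ N ∣ m - PowerSeries.trunc N (m : PowerSeries S₀) := by
      rw [Polynomial.X_pow_dvd_iff]
      intro d hd
      rw [coeff_sub, PowerSeries.coeff_trunc, if_pos hd, Polynomial.coeff_coe, sub_self]
    obtain ⟨k, hk⟩ := hdvd
    have hXN : (X : S₀[X]) ^ N * k ∈ J := by
      rw [← Nat.sub_add_cancel hN, pow_add]
      exact J.mul_mem_right _ (J.mul_mem_left _ hXL)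
    have : PowerSeries.trunc N (m : PowerSeries S₀) = m - X ^ N * k := by rw [← hk]; ring
    rw [this]
    exact J.sub_mem hm hXN
  rw [Ideal.map] at hg
  induction hg using Submodule.span_induction with
  | mem g hg' =>
    obtain ⟨m, hm, rfl⟩ := hg'
    exact key m hm
  | zero => simp
  | add g g' _ _ hg hg' =>
    rw [map_add]
    exact J.add_mem hg hg'
  | smul s g _ hg =>
    rw [smul_eq_mul, ← PowerSeries.trunc_trunc_mul_trunc, ← Polynomial.coe_mul]
    exact key (PowerSeries.trunc N s * PowerSeries.trunc N g) (J.mul_mem_left _ hg)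

/-- **CONTRACTION**: a polynomial lying in `J · S₀⟦X⟧` lies in `J`, provided `X^L ∈ J`. [OURS · R10b §3f] -/
theorem mem_of_coe_mem_map_coe {J : Ideal S₀[X]} {L : ℕ} (hXL : (X : S₀[X]) ^ L ∈ J) {k : S₀[X]}
    (hk : (k : PowerSeries S₀) ∈ J.map (Polynomial.coeToPowerSeries.ringHom : S₀[X] →+* PowerSeries S₀)) : k ∈ J := by
  have h := trunc_mem_of_mem_map_coe hXL hk (N := max L (k.natDegree + 1)) (le_max_left _ _)
  rwa [PowerSeries.trunc_coe_eq_self (lt_of_lt_of_le (Nat.lt_succ_self _) (le_max_right _ _))] at h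

end Contraction

section Frames

variable {S₀ : Type*} [CommRing S₀]

/-- The polynomial frame `(C u₀, C u₁, X − C φ)` of `S₀[X]`. -/
noncomputable def polyFrame (u : Fin 2 → S₀) (φ : S₀) : Fin 3 → S₀[X] :=
  fun i => if i = 0 then C (u 0) else if i = 1 then C (u 1) else X - C φ

@[simp] theorem polyFrame_zero (u : Fin 2 → S₀) (φ : S₀) : polyFrame u φ 0 = C (u 0) := by simp [polyFrame]
@[simp] theorem polyFrame_one (u : Fin 2 → S₀) (φ : S₀) : polyFrame u φ 1 = C (u 1) := by simp [polyFrame]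
@[simp] theorem polyFrame_two (u : Fin 2 → S₀) (φ : S₀) : polyFrame u φ 2 = X - C φ := by
  simp [polyFrame, show (2 : Fin 3) ≠ 0 from by decide, show (2 : Fin 3) ≠ 1 from by decide]

/-- The power-series frame `(C u₀, C u₁, X − C φ)` of `S₀⟦X⟧`. -/
noncomputable def psFrame (u : Fin 2 → S₀) (φ : S₀) : Fin 3 → PowerSeries S₀ :=
  fun i => if i = 0 then PowerSeries.C (u 0) else if i = 1 then PowerSeries.C (u 1) else PowerSeries.X - PowerSeries.C φ

@[simp] theorem psFrame_zero (u : Fin 2 → S₀) (φ : S₀) : psFrame u φ 0 = PowerSeries.C (u 0) := by simp [psFrame]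
@[simp] theorem psFrame_one (u : Fin 2 → S₀) (φ : S₀) : psFrame u φ 1 = PowerSeries.C (u 1) := by simp [psFrame]
@[simp] theorem psFrame_two (u : Fin 2 → S₀) (φ : S₀) : psFrame u φ 2 = PowerSeries.X - PowerSeries.C φ := by
  simp [psFrame, show (2 : Fin 3) ≠ 0 from by decide, show (2 : Fin 3) ≠ 1 from by decide]

theorem coe_comp_polyFrame (u : Fin 2 → S₀) (φ : S₀) :
    (Polynomial.coeToPowerSeries.ringHom : S₀[X] →+* PowerSeries S₀) ∘ polyFrame u φ = psFrame u φ := by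
  funext i
  fin_cases i <;> simp [Polynomial.coeToPowerSeries.ringHom_apply, Polynomial.coe_C, Polynomial.coe_X]

/-- Taylor `X ↦ X + φ` carries the frame at `φ` to the frame at `0`. -/
theorem taylor_comp_polyFrame (u : Fin 2 → S₀) (φ : S₀) :
    (taylorAlgHom φ : S₀[X] →+* S₀[X]) ∘ polyFrame u φ = polyFrame u 0 := by
  funext i
  fin_cases i
  · simp [taylor_C]
  · simp [taylor_C]
  · simp [taylor_X, taylor_C, map_sub]

variable [IsLocalRing S₀]

/-- `𝔪_{S₀⟦X⟧} = (C u₀, C u₁, X − C φ)` when `𝔪_{S₀} = (u₀, u₁)` and `φ ∈ 𝔪_{S₀}`. [OURS · R10b §3f] -/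
theorem maximalIdeal_powerSeries_eq_span_psFrame (u : Fin 2 → S₀) (hm : maximalIdeal S₀ = Ideal.span (Set.range u))
    {φ : S₀} (hφ : φ ∈ maximalIdeal S₀) :
    maximalIdeal (PowerSeries S₀) = Ideal.span (Set.range (psFrame u φ)) := by
  have hmem : ∀ {f : PowerSeries S₀}, f ∈ maximalIdeal (PowerSeries S₀) ↔ PowerSeries.constantCoeff f ∈ maximalIdeal S₀ := by
    intro f
    simp only [IsLocalRing.mem_maximalIdeal, mem_nonunits_iff, PowerSeries.isUnit_iff_constantCoeff]
  -- `C` of an element of `𝔪₀` lies in the span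
  have hC : ∀ a ∈ maximalIdeal S₀, PowerSeries.C a ∈ Ideal.span (Set.range (psFrame u φ)) := by
    intro a ha
    rw [hm] at ha
    have : PowerSeries.C a ∈ (Ideal.span (Set.range u)).map (PowerSeries.C : S₀ →+* PowerSeries S₀) :=
      Ideal.mem_map_of_mem _ ha
    rw [Ideal.map_span] at this
    refine Ideal.span_mono ?_ this
    rintro _ ⟨_, ⟨i, rfl⟩, rfl⟩
    fin_cases i
    · exact ⟨0, by simp⟩
    · exact ⟨1, by simp⟩
  have hX : (PowerSeries.X : PowerSeries S₀) ∈ Ideal.span (Set.range (psFrame u φ)) := by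
    have : (PowerSeries.X : PowerSeries S₀) = (PowerSeries.X - PowerSeries.C φ) + PowerSeries.C φ := by ring
    rw [this]
    exact Ideal.add_mem _ (Ideal.subset_span ⟨2, by simp⟩) (hC φ hφ)
  apply le_antisymm
  · intro f hf
    have hf0 := hmem.mp hf
    have hdec : f = PowerSeries.C (PowerSeries.constantCoeff f) +
        PowerSeries.X * PowerSeries.mk fun p => PowerSeries.coeff (p + 1) f := by
      rw [← PowerSeries.sub_const_eq_X_mul_shift]; ring
    rw [hdec]
    exact Ideal.add_mem _ (hC _ hf0) (Ideal.mul_mem_right _ _ hX)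
  · rw [Ideal.span_le]
    rintro _ ⟨i, rfl⟩
    rw [SetLike.mem_coe, hmem]
    fin_cases i
    · simpa using (show u 0 ∈ maximalIdeal S₀ by rw [hm]; exact Ideal.subset_span ⟨0, rfl⟩)
    · simpa using (show u 1 ∈ maximalIdeal S₀ by rw [hm]; exact Ideal.subset_span ⟨1, rfl⟩)
    · simpa using (maximalIdeal S₀).neg_mem hφ

/-- `X^n` lies in the polynomial monomial ideal of the frame at `φ ∈ (u₀, u₁)`, weights `(q, r₂, r₁)` with `1 ≤ q ≤ r₂, r₁`, level `n`.
[OURS · R10b §3f] -/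
theorem X_pow_mem_monomialIdeal_polyFrame (u : Fin 2 → S₀) {φ : S₀} (hφ : φ ∈ Ideal.span (Set.range u))
    {α : Fin 3 → ℝ} (hα : ∀ j, (1 : ℝ) ≤ α j) (n : ℕ) :
    (X : S₀[X]) ^ n ∈ monomialIdeal (polyFrame u φ) α n := by
  have hXs : (X : S₀[X]) ∈ Ideal.span (Set.range (polyFrame u φ)) := by
    have hCφ : C φ ∈ Ideal.span (Set.range (polyFrame u φ)) := by
      have : C φ ∈ (Ideal.span (Set.range u)).map (C : S₀ →+* S₀[X]) := Ideal.mem_map_of_mem _ hφ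
      rw [Ideal.map_span] at this
      refine Ideal.span_mono ?_ this
      rintro _ ⟨_, ⟨i, rfl⟩, rfl⟩
      fin_cases i
      · exact ⟨0, by simp⟩
      · exact ⟨1, by simp⟩
    have : (X : S₀[X]) = (X - C φ) + C φ := by ring
    rw [this]
    exact Ideal.add_mem _ (Ideal.subset_span ⟨2, by simp⟩) hCφ
  have h1 : (X : S₀[X]) ^ n ∈ Ideal.span (Set.range (polyFrame u φ)) ^ n := Ideal.pow_mem_pow hXs n
  have h2 := span_pow_le_monomialIdeal_one (polyFrame u φ) n h1
  refine Ideal.span_mono ?_ h2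
  rintro m ⟨x, hx, rfl⟩
  refine ⟨x, hx.trans ?_, rfl⟩
  unfold weight
  exact Finset.sum_le_sum fun j _ => by
    simpa using mul_le_mul_of_nonneg_right (hα j) (Nat.cast_nonneg (x j))

end Frames

section Translate

variable {S₀ : Type*} [CommRing S₀] [IsLocalRing S₀]

/-- **§3f THE `g₁`-CLAUSE FOR TRANSLATE FLAGS — NO AUTOMORPHISM, NO COMPLETENESS (R10b · OURS · PROVED)**.  `S₀` Noetherian local,
`𝔪_{S₀} = (u₀, u₁)` radical-generated with (H); `h ∈ S₀[X]` monic of degree `ν ≥ 1` with no solvable vertex (`IsMinimal u h`: the hub first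
member is `X`); `0 < q ≤ r₂ ≤ r₁`; `φ ∈ 𝔪_{S₀}`.  IF THE TRANSLATE FLAG `(X − C φ; C u₁)` REACHES `h` in `S₀⟦X⟧` at level `r₁ ν`, THEN
`φ ∈ I_α(u; 1)`, `α = (q/r₁, r₂/r₁)` — equivalently (`translate_first_member_mem`) `X − C φ ∈ F_{(X; C u₁)}(r₁)`: the hub flag DOMINATES every
reaching translate flag (the `g₂`-clause being trivial for a common second member).  Route: §3d (`F = monomialIdeal` for the frame
`(C u₀, C u₁, X − C φ)` of `S₀⟦X⟧`) → contraction to `S₀[X]` (`mem_of_coe_mem_map_coe`, using `Xⁿ ∈` the polynomial monomial ideal) → Taylor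
`X ↦ X + φ` ON `S₀[X]` (`taylorAlgHom`, an honest automorphism of the polynomial ring) → extension to `S₀⟦X⟧` at the frame `(C u₀, C u₁, X)` → §3d
→ §3c (`DeltaGE`) → §1 (Hironaka (4.8)).  Holds at EVERY admissible `(q; r₁, r₂)`, separable or not.  [OURS · R10b §3f · PROVED · not expert-reviewed] -/
theorem mem_monomialIdeal_of_translate_flag_reaches [IsNoetherianRing S₀] (u : Fin 2 → S₀)
    (hm : maximalIdeal S₀ = Ideal.span (Set.range u))
    (H : ∀ (i : Fin 2) (T : Finset (Fin 2)), i ∉ T →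
      ∀ y, u i * y ∈ Ideal.span (u '' ↑T) → y ∈ Ideal.span (u '' ↑T))
    (hrad : (Ideal.span (Set.range u)).IsRadical)
    {h : S₀[X]} (hh : h.Monic) (hm1 : 1 ≤ h.natDegree) (hmin : IsMinimal u h)
    {q r₁ r₂ : ℕ} (hadm : AdmissibleTriple q r₁ r₂) {φ : S₀} (hφ : φ ∈ maximalIdeal S₀)
    (hreach : (h : PowerSeries S₀) ∈
      flagContactFiltration (PowerSeries.X - PowerSeries.C φ : PowerSeries S₀) (PowerSeries.C (u 1)) q r₁ r₂ (r₁ * h.natDegree)) :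
    φ ∈ monomialIdeal u (bridgeWeights q r₁ r₂) 1 := by
  obtain ⟨hq, hqr₂, hr₂r₁⟩ := hadm
  set n := r₁ * h.natDegree with hn
  have hq1 : ∀ j, (1 : ℝ) ≤ frameWeights q r₁ r₂ j := by
    intro j
    fin_cases j
    · simpa using (show (1 : ℝ) ≤ q by exact_mod_cast hq)
    · simpa using (show (1 : ℝ) ≤ r₂ by exact_mod_cast (le_trans hq hqr₂))
    · simpa using (show (1 : ℝ) ≤ r₁ by exact_mod_cast (le_trans hq (hqr₂.trans hr₂r₁)))
  -- Step 1: `F_(X − Cφ; C u₁)(n)` is the monomial ideal of the power-series frame at `φ`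
  have hmP := maximalIdeal_powerSeries_eq_span_psFrame u hm hφ
  have e1 := flagContactFiltration_eq_monomialIdeal (psFrame u φ) hmP ⟨hq, hqr₂, hr₂r₁⟩ n
  rw [psFrame_two, psFrame_one] at e1
  rw [e1] at hreach
  -- Step 2: it is extended from `S₀[X]`; contract
  have e2 : monomialIdeal (psFrame u φ) (frameWeights q r₁ r₂) (n : ℝ) =
      (monomialIdeal (polyFrame u φ) (frameWeights q r₁ r₂) (n : ℝ)).map
        (Polynomial.coeToPowerSeries.ringHom : S₀[X] →+* PowerSeries S₀) := by
    rw [← monomialIdeal_comp_eq_map, coe_comp_polyFrame]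
  rw [e2] at hreach
  have hφ' : φ ∈ Ideal.span (Set.range u) := hm ▸ hφ
  have hXn := X_pow_mem_monomialIdeal_polyFrame u hφ' hq1 n
  have hh1 : h ∈ monomialIdeal (polyFrame u φ) (frameWeights q r₁ r₂) (n : ℝ) := mem_of_coe_mem_map_coe hXn hreach
  -- Step 3: Taylor on `S₀[X]`
  have hh2 : taylor φ h ∈ monomialIdeal (polyFrame u 0) (frameWeights q r₁ r₂) (n : ℝ) := by
    have := Ideal.mem_map_of_mem (taylorAlgHom φ : S₀[X] →+* S₀[X]) hh1
    rw [← monomialIdeal_comp_eq_map, taylor_comp_polyFrame] at this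
    exact this
  -- Step 4: extend to `S₀⟦X⟧` at the frame `(C u₀, C u₁, X)`
  have hh3 : ((taylor φ h : S₀[X]) : PowerSeries S₀) ∈ monomialIdeal (psFrame u 0) (frameWeights q r₁ r₂) (n : ℝ) := by
    rw [← coe_comp_polyFrame, monomialIdeal_comp_eq_map]
    simpa [Polynomial.coeToPowerSeries.ringHom_apply] using
      Ideal.mem_map_of_mem (Polynomial.coeToPowerSeries.ringHom : S₀[X] →+* PowerSeries S₀) hh2
  -- Step 5: which is `F_(X; C u₁)(n)`
  have hmP0 := maximalIdeal_powerSeries_eq_span_psFrame u hm (φ := 0) (Ideal.zero_mem _)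
  have e0 := flagContactFiltration_eq_monomialIdeal (psFrame u 0) hmP0 ⟨hq, hqr₂, hr₂r₁⟩ n
  rw [psFrame_two, psFrame_one, map_zero, sub_zero] at e0
  rw [← e0] at hh3
  -- Step 6: §3e = §3c + §1
  exact mem_monomialIdeal_of_translate_reaches u hm H hrad hh hm1 hmin ⟨hq, hqr₂, hr₂r₁⟩ φ hh3

/-- §3f in flag words: under its hypotheses, `X − C φ ∈ F_{(X; C u₁)}(r₁)` — the hub flag `(X; C u₁)` dominates the reaching translate flag
`(X − C φ; C u₁)` in the sense of SPEC (Δ12) rev 4 l.223 (first-member clause; the second members coincide). [OURS · R10b §3f · PROVED] -/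
theorem translate_first_member_mem [IsNoetherianRing S₀] (u : Fin 2 → S₀)
    (hm : maximalIdeal S₀ = Ideal.span (Set.range u))
    (H : ∀ (i : Fin 2) (T : Finset (Fin 2)), i ∉ T →
      ∀ y, u i * y ∈ Ideal.span (u '' ↑T) → y ∈ Ideal.span (u '' ↑T))
    (hrad : (Ideal.span (Set.range u)).IsRadical)
    {h : S₀[X]} (hh : h.Monic) (hm1 : 1 ≤ h.natDegree) (hmin : IsMinimal u h)
    {q r₁ r₂ : ℕ} (hadm : AdmissibleTriple q r₁ r₂) {φ : S₀} (hφ : φ ∈ maximalIdeal S₀)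
    (hreach : (h : PowerSeries S₀) ∈
      flagContactFiltration (PowerSeries.X - PowerSeries.C φ : PowerSeries S₀) (PowerSeries.C (u 1)) q r₁ r₂ (r₁ * h.natDegree)) :
    PowerSeries.X - PowerSeries.C φ ∈
      flagContactFiltration (PowerSeries.X : PowerSeries S₀) (PowerSeries.C (u 1)) q r₁ r₂ r₁ := by
  have hφ1 := mem_monomialIdeal_of_translate_flag_reaches u hm H hrad hh hm1 hmin hadm hφ hreach
  have hq : 0 < q := hadm.1
  refine Ideal.sub_mem _ ?_ ?_
  · rw [flagContactFiltration_def]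
    refine Submodule.mem_iSup_of_mem 1 (Submodule.mem_iSup_of_mem 0 ?_)
    have h0 : (r₁ - r₁ * 1 - r₂ * 0 + q - 1) / q = 0 := by
      rw [Nat.div_eq_zero_iff]; right; omega
    have hX : (PowerSeries.X : PowerSeries S₀) ∈
        Ideal.span {(PowerSeries.X : PowerSeries S₀) ^ 1 * PowerSeries.C (u 1) ^ 0} := by
      simp [Ideal.mem_span_singleton_self]
    have h1 : (1 : PowerSeries S₀) ∈ maximalIdeal (PowerSeries S₀) ^ ((r₁ - r₁ * 1 - r₂ * 0 + q - 1) / q) := by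
      rw [h0, pow_zero, Ideal.one_eq_top]; exact Submodule.mem_top
    simpa using Ideal.mul_mem_mul hX h1
  · have := C_mul_X_pow_mem_flagContactFiltration u hm hadm (ν := 1) (i := 0) (Nat.zero_le 1) (c := φ) (by simpa using hφ1)
    simpa using this

end Translate

section Weierstrass

variable {S₀ : Type*} [CommRing S₀] [IsLocalRing S₀]

/-- The two-flag filtration only sees the first member up to units. [folklore] -/
theorem flagContactFiltration_mul_unit (g₁ g₂ v : PowerSeries S₀) (hv : IsUnit v) (q r₁ r₂ n : ℕ) :
    flagContactFiltration (g₁ * v) g₂ q r₁ r₂ n = flagContactFiltration g₁ g₂ q r₁ r₂ n := by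
  rw [flagContactFiltration_def, flagContactFiltration_def]
  refine iSup_congr fun a => iSup_congr fun b => ?_
  rw [show (g₁ * v) ^ a * g₂ ^ b = v ^ a * (g₁ ^ a * g₂ ^ b) by ring, Ideal.span_singleton_mul_left_unit (hv.pow a)]

/-- A Weierstrass factor of a power series of `X`-order one (`g(0) ∈ 𝔪₀`, `g'(0) ∉ 𝔪₀`) has degree one. [OURS · R10b §3g · bookkeeping] -/
theorem natDegree_eq_one_of_isWeierstrassFactorization {g : PowerSeries S₀} {f : S₀[X]} {v : PowerSeries S₀}
    (hW : g.IsWeierstrassFactorization f v) (hg0 : PowerSeries.constantCoeff g ∈ maximalIdeal S₀)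
    (hg1 : PowerSeries.coeff 1 g ∉ maximalIdeal S₀) : f.natDegree = 1 := by
  have hmon := hW.isDistinguishedAt.monic
  have hvu : IsUnit (PowerSeries.constantCoeff v) := PowerSeries.isUnit_iff_constantCoeff.mp hW.isUnit
  rcases Nat.lt_or_ge f.natDegree 1 with hd | hd
  · -- degree 0: `f = 1`, so `g = v` is a unit
    exfalso
    have hf1 : f = 1 := Polynomial.eq_one_of_monic_natDegree_zero hmon (by omega)
    have : IsUnit (PowerSeries.constantCoeff g) := by
      rw [hW.eq_mul, hf1]; simpa using hvu
    exact (IsLocalRing.mem_maximalIdeal _ |>.mp hg0) this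
  rcases hd.eq_or_lt with hd1 | hd2
  · exact hd1.symm
  · -- degree ≥ 2: `f₀, f₁ ∈ 𝔪₀` force `coeff 1 g ∈ 𝔪₀`
    exfalso
    have hf0 : f.coeff 0 ∈ maximalIdeal S₀ := hW.isDistinguishedAt.mem (by omega)
    have hf1 : f.coeff 1 ∈ maximalIdeal S₀ := hW.isDistinguishedAt.mem (by omega)
    apply hg1
    have h01 : (Finset.HasAntidiagonal.antidiagonal 1 : Finset (ℕ × ℕ)) = {((0 : ℕ), (1 : ℕ)), (1, 0)} := by decide
    rw [hW.eq_mul, PowerSeries.coeff_mul, h01, Finset.sum_pair (by decide)]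
    simp only [Polynomial.coeff_coe]
    exact Ideal.add_mem _ (Ideal.mul_mem_right _ _ hf0) (Ideal.mul_mem_right _ _ hf1)

/-- **§3g EVERY FIRST MEMBER OF `X`-ORDER ONE (R10b · OURS · PROVED; `S₀` complete)**.  With `S₀` Noetherian local and `𝔪_{S₀}`-adically
complete (Weierstrass preparation, Mathlib `PowerSeries.exists_isWeierstrassFactorization`), §3f upgrades from translates `X − C φ` to EVERY
first member `g₁ ∈ S₀⟦X⟧` with `g₁(0) ∈ 𝔪_{S₀}` and `∂g₁/∂X (0) ∉ 𝔪_{S₀}` (i.e. `g₁ = unit · (X − C φ)`): if the flag `(g₁; C u₁)` reaches the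
hub germ `h` at level `r₁ ν`, then `g₁ ∈ F_{(X; C u₁)}(r₁)` — the hub flag dominates it (first-member clause of SPEC (Δ12) rev 4 l.223; the
second members coincide).  What is still NOT covered: competing flags with ANOTHER second member, and first members with `∂g₁/∂X(0) ∈ 𝔪_{S₀}`
(linear part inside `(x, g₂)`).  [OURS · R10b §3g · PROVED · not expert-reviewed] -/
theorem first_member_mem_of_flag_reaches [IsNoetherianRing S₀] [IsAdicComplete (maximalIdeal S₀) S₀] (u : Fin 2 → S₀)
    (hm : maximalIdeal S₀ = Ideal.span (Set.range u))
    (H : ∀ (i : Fin 2) (T : Finset (Fin 2)), i ∉ T →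
      ∀ y, u i * y ∈ Ideal.span (u '' ↑T) → y ∈ Ideal.span (u '' ↑T))
    (hrad : (Ideal.span (Set.range u)).IsRadical)
    {h : S₀[X]} (hh : h.Monic) (hm1 : 1 ≤ h.natDegree) (hmin : IsMinimal u h)
    {q r₁ r₂ : ℕ} (hadm : AdmissibleTriple q r₁ r₂) {g₁ : PowerSeries S₀}
    (hg0 : PowerSeries.constantCoeff g₁ ∈ maximalIdeal S₀) (hg1 : PowerSeries.coeff 1 g₁ ∉ maximalIdeal S₀)
    (hreach : (h : PowerSeries S₀) ∈
      flagContactFiltration g₁ (PowerSeries.C (u 1)) q r₁ r₂ (r₁ * h.natDegree)) :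
    g₁ ∈ flagContactFiltration (PowerSeries.X : PowerSeries S₀) (PowerSeries.C (u 1)) q r₁ r₂ r₁ := by
  have hg : g₁.map (IsLocalRing.residue S₀) ≠ 0 := by
    intro h0
    apply hg1
    have := congrArg (PowerSeries.coeff 1) h0
    rw [PowerSeries.coeff_map, map_zero] at this
    exact (IsLocalRing.residue_eq_zero_iff _).mp this
  obtain ⟨f, v, hW⟩ := PowerSeries.exists_isWeierstrassFactorization hg
  have hd := natDegree_eq_one_of_isWeierstrassFactorization hW hg0 hg1
  set φ : S₀ := - f.coeff 0 with hφdef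
  have hφ : φ ∈ maximalIdeal S₀ := (maximalIdeal S₀).neg_mem (hW.isDistinguishedAt.mem (by omega))
  have hf : (f : PowerSeries S₀) = PowerSeries.X - PowerSeries.C φ := by
    have := Polynomial.Monic.eq_X_add_C hW.isDistinguishedAt.monic hd
    rw [this, hφdef]
    simp [Polynomial.coe_C, Polynomial.coe_X]
  have hreach' : (h : PowerSeries S₀) ∈ flagContactFiltration (PowerSeries.X - PowerSeries.C φ : PowerSeries S₀)
      (PowerSeries.C (u 1)) q r₁ r₂ (r₁ * h.natDegree) := by
    rw [hW.eq_mul, flagContactFiltration_mul_unit _ _ _ hW.isUnit, hf] at hreach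
    exact hreach
  have hmem := translate_first_member_mem u hm H hrad hh hm1 hmin hadm hφ hreach'
  rw [hW.eq_mul, hf]
  exact Ideal.mul_mem_right _ _ hmem

end Weierstrass

section BaseCase

variable {S : Type*} [CommRing S] [IsLocalRing S]

private theorem ceilDiv_le_add_ceilDiv (m q β : ℕ) (hq : 0 < q) :
    (m + q - 1) / q ≤ β + (m - q * β + q - 1) / q := by
  rcases le_or_gt (q * β) m with h | h
  · have : m + q - 1 = (m - q * β + q - 1) + q * β := by omega
    rw [this, Nat.add_mul_div_left _ _ hq]; omega
  · have h2 : (m + q - 1) / q < β + 1 := by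
      rw [Nat.div_lt_iff_lt_mul hq]
      have : (β + 1) * q = q * β + q := by ring
      rw [this]; omega
    exact le_trans (Nat.le_of_lt_succ h2) (Nat.le_add_right _ _)

/-- **§3h BASE CASE `r₂ = q` (R10c · OURS · PROVED).**  When the second member carries the minimal weight `r₂ = q`, the two-flag
filtration FORGETS the second member: `F_{(g₁; g₂)}^{(q; r₁, q)}(n) = Σ_α (g₁^α)·𝔪^{⌈(n − r₁ α)/q⌉}` for any `g₂ ∈ 𝔪`.  [OURS · R10c §3h] -/
theorem flagContactFiltration_eq_iSup_of_r₂_eq_q (g₁ g₂ : S) (hg₂ : g₂ ∈ maximalIdeal S) (q r₁ n : ℕ) (hq : 0 < q) :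
    flagContactFiltration g₁ g₂ q r₁ q n = ⨆ α : ℕ, Ideal.span {g₁ ^ α} * maximalIdeal S ^ ((n - r₁ * α + q - 1) / q) := by
  rw [flagContactFiltration_def]
  apply le_antisymm
  · refine iSup₂_le fun α β => ?_
    refine le_trans ?_ (le_iSup _ α)
    calc Ideal.span {g₁ ^ α * g₂ ^ β} * maximalIdeal S ^ ((n - r₁ * α - q * β + q - 1) / q)
        = Ideal.span {g₁ ^ α} * (Ideal.span {g₂ ^ β} * maximalIdeal S ^ ((n - r₁ * α - q * β + q - 1) / q)) := by
          rw [← Ideal.span_singleton_mul_span_singleton, mul_assoc]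
      _ ≤ Ideal.span {g₁ ^ α} * (maximalIdeal S ^ β * maximalIdeal S ^ ((n - r₁ * α - q * β + q - 1) / q)) := by
          apply Ideal.mul_mono_right; apply Ideal.mul_mono_left
          rw [Ideal.span_singleton_le_iff_mem]; exact Ideal.pow_mem_pow hg₂ β
      _ = Ideal.span {g₁ ^ α} * maximalIdeal S ^ (β + (n - r₁ * α - q * β + q - 1) / q) := by rw [← pow_add]
      _ ≤ Ideal.span {g₁ ^ α} * maximalIdeal S ^ ((n - r₁ * α + q - 1) / q) := by
          apply Ideal.mul_mono_right
          exact Ideal.pow_le_pow_right (ceilDiv_le_add_ceilDiv (n - r₁ * α) q β hq)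
  · refine iSup_le fun α => ?_
    refine le_trans ?_ (le_iSup₂ (f := fun α β => Ideal.span {g₁ ^ α * g₂ ^ β} *
      maximalIdeal S ^ ((n - r₁ * α - q * β + q - 1) / q)) α 0)
    simp

/-- `r₂ = q`: the filtration does not depend on the second member. [OURS · R10c §3h] -/
theorem flagContactFiltration_eq_of_r₂_eq_q (g₁ g₂ g₂' : S) (hg₂ : g₂ ∈ maximalIdeal S) (hg₂' : g₂' ∈ maximalIdeal S)
    (q r₁ n : ℕ) (hq : 0 < q) :
    flagContactFiltration g₁ g₂ q r₁ q n = flagContactFiltration g₁ g₂' q r₁ q n := by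
  rw [flagContactFiltration_eq_iSup_of_r₂_eq_q g₁ g₂ hg₂ q r₁ n hq, flagContactFiltration_eq_iSup_of_r₂_eq_q g₁ g₂' hg₂' q r₁ n hq]

/-- `r₂ = q`: the SECOND-MEMBER clause of dominance is free — every `g₂' ∈ 𝔪` lies in `F_{(g₁; g₂)}(q)`. [OURS · R10c §3h] -/
theorem second_member_mem_of_r₂_eq_q (g₁ g₂ g₂' : S) (hg₂ : g₂ ∈ maximalIdeal S) (hg₂' : g₂' ∈ maximalIdeal S)
    (q r₁ : ℕ) (hq : 0 < q) :
    g₂' ∈ flagContactFiltration g₁ g₂ q r₁ q q := by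
  rw [flagContactFiltration_eq_iSup_of_r₂_eq_q g₁ g₂ hg₂ q r₁ q hq]
  refine Ideal.mem_iSup_of_mem 0 ?_
  have h1 : (q - r₁ * 0 + q - 1) / q = 1 := by
    rw [mul_zero, Nat.sub_zero]
    have : q + q - 1 = q * 1 + (q - 1) := by omega
    rw [this, Nat.mul_add_div hq, Nat.div_eq_of_lt (by omega)]
  rw [pow_zero, Ideal.span_singleton_one, Ideal.top_mul, h1, pow_one]
  exact hg₂'

/-- **§3h FULL DOMINANCE AT `r₂ = q` (R10c · OURS · PROVED; `S₀` complete).**  In the model `S₀⟦X⟧` with the hub flag `(X; C u₁)` (`h` minimal),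
at every admissible triple with `r₂ = q` BOTH clauses of SPEC rev 4 l.223 hold for EVERY competing two-flag `(g₁'; g₂')` with `g₂' ∈ 𝔪`
and `g₁'` of X-order one: reaching ⇒ `g₁' ∈ F_hub(r₁)` and `g₂' ∈ F_hub(q)`.  (By §3h the second member is invisible at `r₂ = q`, so §3g
applies to `(g₁'; C u₁)`.)  [OURS · R10c §3h · PROVED · not expert-reviewed] -/
theorem dominance_of_r₂_eq_q {S₀ : Type*} [CommRing S₀] [IsLocalRing S₀] [IsNoetherianRing S₀] [IsAdicComplete (maximalIdeal S₀) S₀] (u : Fin 2 → S₀)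
    (hm : maximalIdeal S₀ = Ideal.span (Set.range u))
    (H : ∀ (i : Fin 2) (T : Finset (Fin 2)), i ∉ T →
      ∀ y, u i * y ∈ Ideal.span (u '' ↑T) → y ∈ Ideal.span (u '' ↑T))
    (hrad : (Ideal.span (Set.range u)).IsRadical)
    {h : S₀[X]} (hh : h.Monic) (hm1 : 1 ≤ h.natDegree) (hmin : IsMinimal u h)
    {q r₁ : ℕ} (hadm : AdmissibleTriple q r₁ q) {g₁ g₂ : PowerSeries S₀}
    (hg0 : PowerSeries.constantCoeff g₁ ∈ maximalIdeal S₀) (hg1 : PowerSeries.coeff 1 g₁ ∉ maximalIdeal S₀)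
    (hg₂ : g₂ ∈ maximalIdeal (PowerSeries S₀))
    (hreach : (h : PowerSeries S₀) ∈ flagContactFiltration g₁ g₂ q r₁ q (r₁ * h.natDegree)) :
    g₁ ∈ flagContactFiltration (PowerSeries.X : PowerSeries S₀) (PowerSeries.C (u 1)) q r₁ q r₁ ∧
      g₂ ∈ flagContactFiltration (PowerSeries.X : PowerSeries S₀) (PowerSeries.C (u 1)) q r₁ q q := by
  have hq : 0 < q := hadm.1
  have hCu : PowerSeries.C (u 1) ∈ maximalIdeal (PowerSeries S₀) := by
    rw [mem_maximalIdeal_powerSeries_iff, PowerSeries.constantCoeff_C, hm]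
    exact Ideal.subset_span ⟨1, rfl⟩
  refine ⟨?_, second_member_mem_of_r₂_eq_q _ _ _ hCu hg₂ q r₁ hq⟩
  rw [flagContactFiltration_eq_of_r₂_eq_q g₁ g₂ (PowerSeries.C (u 1)) hg₂ hCu q r₁ _ hq] at hreach
  exact first_member_mem_of_flag_reaches u hm H hrad hh hm1 hmin hadm hg0 hg1 hreach

end BaseCase

section NextTarget

/-- **§4 NEXT TARGET (R10c · OURS · CANDIDATE STATEMENT, UNPROVED; evidence = the ROUND-10 census, 0 exceptions).**  The SECOND-MEMBER clause of
SPEC (Δ12) rev 4 l.223 `TwoFlagDominanceAtLevelAt` in the model `S₀⟦X⟧`, at a ratio-maximal admissible triple with `r₂ > q` allowed: if the hub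
flag `(X; C u₁)` (`h` Hironaka-minimal) and a competing flag `(X − C φ; C y')` (`y'` a regular parameter of `S₀`) both reach `h` at
`(q; r₁, r₂)`, and no hub-reached admissible triple has a larger ratio `r₁'/r₂'`, then `C y' ∈ F_hub(r₂)` — by §3d equivalently
`y' ∈ (u₁) + (u₀^⌈r₂/q⌉)`: competing second members agree with `u₁` to `u₀`-order `⌈r₂/q⌉`.  At `r₂ = q` this is §3h; at `r₂ > q` it is the
secondary `(u₁)`-polygon case (`in_δ(h)` `u₀`-free) = a second Hironaka preparation one dimension down (Cossart–Piltant well-preparedness,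
Cossart–Jannsen–Saito Ch. 8–9) — OPEN.  The first member of the competitor is taken as a translate `X − C φ` (§3g reduces X-order-one first
members to this by Weierstrass; second members reduce to constants `C y'` modulo the first member by Weierstrass division — both reductions
are bookkeeping for the successor).  [OURS · R10c §4 · candidate, NOT a fact · AI work weaker than expert review] -/
def SecondMemberClause (S₀ : Type*) [CommRing S₀] [IsLocalRing S₀] : Prop :=
  ∀ (u : Fin 2 → S₀) (h : S₀[X]) (q r₁ r₂ : ℕ) (φ y' : S₀),
    maximalIdeal S₀ = Ideal.span (Set.range u) →
    (∀ (i : Fin 2) (T : Finset (Fin 2)), i ∉ T → ∀ w, u i * w ∈ Ideal.span (u '' ↑T) → w ∈ Ideal.span (u '' ↑T)) →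
    h.Monic → 1 ≤ h.natDegree → IsMinimal u h → AdmissibleTriple q r₁ r₂ →
    φ ∈ maximalIdeal S₀ → y' ∈ maximalIdeal S₀ → y' ∉ maximalIdeal S₀ ^ 2 →
    (∀ q' r₁' r₂' : ℕ, AdmissibleTriple q' r₁' r₂' →
      (h : PowerSeries S₀) ∈ flagContactFiltration (PowerSeries.X : PowerSeries S₀) (PowerSeries.C (u 1)) q' r₁' r₂' (r₁' * h.natDegree) →
      r₁' * r₂ ≤ r₁ * r₂') →
    (h : PowerSeries S₀) ∈ flagContactFiltration (PowerSeries.X : PowerSeries S₀) (PowerSeries.C (u 1)) q r₁ r₂ (r₁ * h.natDegree) →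
    (h : PowerSeries S₀) ∈ flagContactFiltration (PowerSeries.X - PowerSeries.C φ) (PowerSeries.C y') q r₁ r₂ (r₁ * h.natDegree) →
    PowerSeries.C y' ∈ flagContactFiltration (PowerSeries.X : PowerSeries S₀) (PowerSeries.C (u 1)) q r₁ r₂ r₂

/-- The `r₂ = q` instance of §4 is §3h (no maximality, minimality or flag hypothesis needed there). [OURS · R10c §4 · PROVED] -/
theorem secondMemberClause_of_r₂_eq_q {S₀ : Type*} [CommRing S₀] [IsLocalRing S₀] (u : Fin 2 → S₀)
    (hm : maximalIdeal S₀ = Ideal.span (Set.range u)) {q r₁ : ℕ} (hadm : AdmissibleTriple q r₁ q) {y' : S₀}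
    (hy' : y' ∈ maximalIdeal S₀) :
    PowerSeries.C y' ∈ flagContactFiltration (PowerSeries.X : PowerSeries S₀) (PowerSeries.C (u 1)) q r₁ q q := by
  have hCu : PowerSeries.C (u 1) ∈ maximalIdeal (PowerSeries S₀) := by
    rw [mem_maximalIdeal_powerSeries_iff, PowerSeries.constantCoeff_C, hm]
    exact Ideal.subset_span ⟨1, rfl⟩
  have hCy : PowerSeries.C y' ∈ maximalIdeal (PowerSeries S₀) := by
    rw [mem_maximalIdeal_powerSeries_iff, PowerSeries.constantCoeff_C]; exact hy'
  exact second_member_mem_of_r₂_eq_q _ _ _ hCu hCy q r₁ hadm.1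

end NextTarget





end Summit.ResolutionOfSingularities.ResolutionOfSingularities.Cruxes.HypersurfaceCentreConstruction.LocalEngine.Iota3.JCanCensus

namespace Summit.ResolutionOfSingularities.ResolutionOfSingularities.Cruxes.HypersurfaceCentreConstruction.LocalEngine

namespace Iota3

namespace JCanCensus


/-- **DICTIONARY TO (o70-b)** [OURS · CANDIDATE · R10b].  At a position of order `ν` with a two-flag `(g₁, g₂)` completed by `x` to a
regular system of parameters of the completion `Ŝ ≅ S₀[[g₁]] ⊇ S₀[X]`, `S₀ = k[[x, g₂]]` (Cohen), and in the regime `r₁ > r₂ ≥ q` (where a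
reaching `f` is `g₁`-regular of order `ν`: every monomial `xᵃ g₂ᵇ g₁ᶜ` with `a + b ≥ 1`, `a + b + c = ν` has weight `< ν r₁`), Weierstrass
gives `f = unit · h`, `h ∈ S₀[X]` monic of degree `ν` in `X = g₁`.  Put `u = (x, g₂) : Fin 2 → S₀` and `α = (q/r₁, r₂/r₁)`.  Then:
* «the flag `(x; g₂, g₁ + φ)`, `φ ∈ S₀`, carries `f` to level `ν r₁` at `(q; r₁, r₂)`» ⟺ `DeltaGE u α (taylor φ h) 1` (coefficientwise:
  `coeff_{ν-i} ∈ monomialIdeal u α i`, i.e. `W(f_i) ≥ i r₁`);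
* «`g₁ + φ ∈ F_{(g₁,g₂)}(r₁)`» (the `g₁`-clause of `Dominates`) ⟸ `φ ∈ monomialIdeal u α 1` (`W(φ) ≥ r₁`);
* so `IsMinimal.mem_monomialIdeal_of_deltaGE_taylor` with `q = 1` reads: a flag whose first member `g₁` is HIRONAKA-MINIMAL w.r.t.
  `(x, g₂; g₁)` (no solvable vertex, all weights) DOMINATES, in the `g₁`-clause, every reaching flag `(x; g₂, unit·(g₁ + φ(x, g₂)))` — at
  EVERY weight vector, not only at the σ-maximal one (this matches the shape of SPEC rev 4 l.223, which quantifies over levels), and with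
  no separability hypothesis on the first face (the `p`-th-power tower is exactly the solvable-vertex cascade that minimality has already
  exhausted); a minimal hub exists in the completion (`CossartPiltant.exists_isMinimum_taylor_of_isAdicComplete`), is level-maximal among
  translates (`IsMinimal.deltaGE_of_deltaGE_taylor`), and with UPGRADE (res-D-brk-1 `IsTwoFlag.dominant_symm`) + the hub corollary
  (Sketch-R10 §4 `jSigmaCanonicalAt_of_hub`) mutual dominance of all such flags follows.
* §3 PROVES the bridge (c) below at the flag `(X; C u₁)` of `S₀⟦X⟧` and the identity `F = monomialIdeal` in any local `S` (rev 3).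
* WHAT THIS DOES NOT COVER (honest): (a) second members / frames — flags with a different `(x, g₂)` (res-D-brk-1 PART 2c–2f; the axis
  restriction TR-y of IDEAS R10.2 is the `N = 1` instance of the same theorem applied to the face polynomial in `g₂` over `k[[x]]`, which
  needs RATIO-maximality to make the face non-solvable); (b) first members whose linear part lies in `span(x, g₂)` (not a unit multiple of
  a translate); (c) the bridge `flagContactFiltration` (intrinsic, in `S`) ↔ `DeltaGE` (coefficientwise, in `S₀[X] ⊂ Ŝ`): faithful
  flatness `S → Ŝ` and the monomial description of `F(n)` in the regular parameters `(x, g₂, g₁)`; (d) σ-maximal but NOT fully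
  vertex-prepared first members are handled through the hub, not directly.
[OURS · R10b · EVIDENCE / CANDIDATE DICTIONARY, not a theorem about the w43 objects] -/
theorem hironakaHubDictionary : True := trivial

end JCanCensus

end Iota3

end Summit.ResolutionOfSingularities.ResolutionOfSingularities.Cruxes.HypersurfaceCentreConstruction.LocalEngine
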